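import Literature.Computability.Complexity.HiraharaAsymptotics
import Literature.Computability.Complexity.CSPToCMMSAMachine
import HarnessLib

/-!
# Hirahara's reduction: preprocessing a CMMSA instance

Topic `Computability/Complexity`. The elementary first stage of the reduction from
`gapCMMSA (Δ^α) (Δ^{-α}) sqrtLog` to `MCSP*` (Hirahara, ECCC TR22-119, proof of Thm. 8.5 with
Lemma 8.3): from a CMMSA instance `I₀ = (n, Φ, w, θ)` (`MetaComplexity/CMMSA.lean`) to the
preprocessed instance `Pre.toPInst I₀ : HiraharaRed.PInst` of `HiraharaInstance.lean` — delete the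
zero-weight literals (those variables are free), keep the reduced formulas that are not identically
true, index them by `Fin ν`, and fix `λ = 2^{Λ}` with `Λ = 4(⌊log₂ L'⌋ + 1) + 4096`, `L' = n + m + W` — together
with the translation of the promise:

* `Pre.toPInst_good`, `Pre.toPInst_big` — the well-formedness / largeness hypotheses of the instance
  files hold for well-formed instances of degree `≤ Δ(n)` with `n ≥ 2`, no empty formula and
  `θ < W` (total weight);
* `Pre.exists_witness_of_yes` — a light satisfying assignment yields a set `T` of positive-weight
  variables of weight `≤ θ` accepted by every kept formula;
* `Pre.heavy_of_no` — under the no-promise (`ε ≤ 1`, `0 ≤ g`), every set accepted by all kept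
  formulas has weight `> ⌊g(n) θ⌋`.

## References

* S. Hirahara, *NP-hardness of learning programs and partial MCSP*, ECCC TR22-119, Def. 5.1,
  proof of Thm. 8.5 and of Lemma 8.3 [Hirahara2022PartialMCSP].
-/

namespace Literature.Computability.Complexity

open Finset
open Literature.Computability.MetaComplexity (MonotoneDNF MCSPStar sqrtLog CMMSAInstance)
open CSPToCMMSAMachine (toE toE_eq)

namespace HiraharaRed

namespace Pre

variable (I₀ : CMMSAInstance)

/-! ### The preprocessing -/

/-- Deleting the zero-weight literals of a formula (those variables are set to true for free).
[cite: Hirahara2022PartialMCSP, proof of Thm. 8.5 (w.l.o.g. reductions of the instance)] -/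
def redFormula (φ : MonotoneDNF) : MonotoneDNF := φ.map fun t => t.filter fun v => decide (I₀.w v ≠ 0)

/-- The kept formulas: reduced formulas that are not identically true (no empty term).
[cite: Hirahara2022PartialMCSP, proof of Thm. 8.5] -/
def kept : List MonotoneDNF := (I₀.formulas.map (redFormula I₀)).filter fun φ => decide ([] ∉ φ)

/-- The code length of the instance. [folklore] -/
def codeLen : ℕ := (CMMSAInstance.encoding.encode I₀).length

/-- The total weight `W = Σ_{i<n} w(i)`. [folklore] -/
def totalW : ℕ := ∑ i ∈ Finset.range I₀.numVars, I₀.w i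

/-- The size measure `L' = n + m + W` (at most twice the code length for well-formed instances,
`sizeOf_le`; chosen for being trivially computable from the tuple). [folklore] -/
def sizeOf : ℕ := I₀.numVars + I₀.numFormulas + totalW I₀

/-- `Λ = 4(⌊log₂ L'⌋ + 1) + 4096`. [cite: Hirahara2022PartialMCSP, proof of Lemma 8.3 (choice of λ := poly(n, m, w_max, …))] -/
def logLamOf : ℕ := 4 * (Nat.log 2 (sizeOf I₀) + 1) + 4096

/-- **The preprocessed instance.** [cite: Hirahara2022PartialMCSP, proof of Thm. 8.5 and of Lemma 8.3] -/
def toPInst : PInst where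
  n := I₀.numVars
  ν := (kept I₀).length
  φ j := (kept I₀)[j.val]'j.isLt
  w k := I₀.w k
  θ := I₀.threshold
  logLam := logLamOf I₀

/-! ### Reduced formulas and assignments -/

variable {I₀}

/-- A reduced formula evaluates at `a` as the original at `a ∨ [w = 0]`. [folklore] -/
theorem eval_redFormula (φ : MonotoneDNF) (a : ℕ → Bool) :
    (redFormula I₀ φ).eval a = φ.eval fun v => a v || decide (I₀.w v = 0) := by
  rw [Bool.eq_iff_iff, MonotoneDNF.eval_eq_true_iff, MonotoneDNF.eval_eq_true_iff]
  unfold redFormula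
  constructor
  · rintro ⟨t', ht', hall⟩
    obtain ⟨t, ht, rfl⟩ := List.mem_map.1 ht'
    refine ⟨t, ht, fun i hi => ?_⟩
    by_cases hw : I₀.w i = 0
    · simp [hw]
    · have : i ∈ t.filter fun v => decide (I₀.w v ≠ 0) := List.mem_filter.2 ⟨hi, by simpa using hw⟩
      simp [hall i this]
  · rintro ⟨t, ht, hall⟩
    refine ⟨_, List.mem_map.2 ⟨t, ht, rfl⟩, fun i hi => ?_⟩
    obtain ⟨hit, hwi⟩ := List.mem_filter.1 hi
    have h := hall i hit
    have hw : I₀.w i ≠ 0 := by simpa using hwi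
    simpa [hw] using h

/-- Reduction does not increase the literal count. [folklore] -/
theorem numLiterals_redFormula_le (φ : MonotoneDNF) : (redFormula I₀ φ).numLiterals ≤ φ.numLiterals := by
  unfold redFormula MonotoneDNF.numLiterals
  rw [List.map_map]
  induction φ with
  | nil => simp
  | cons t ts ih =>
    simp only [List.map_cons, List.sum_cons, Function.comp_apply]
    exact Nat.add_le_add (List.length_filter_le _ _) ih

/-- Reduction keeps formulas over `[n]`. [folklore] -/
theorem isOver_redFormula {n : ℕ} {φ : MonotoneDNF} (h : φ.IsOver n) : (redFormula I₀ φ).IsOver n := by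
  intro t' ht' i hi
  unfold redFormula at ht'
  obtain ⟨t, ht, rfl⟩ := List.mem_map.1 ht'
  exact h t ht i (List.mem_filter.1 hi).1

/-- Reduction keeps nonempty formulas nonempty. [folklore] -/
theorem redFormula_ne_nil {φ : MonotoneDNF} (h : φ ≠ []) : redFormula I₀ φ ≠ [] := by
  unfold redFormula; simpa using h

/-- Membership in the kept list. [folklore] -/
theorem mem_kept_iff {ψ : MonotoneDNF} : ψ ∈ kept I₀ ↔ (∃ φ ∈ I₀.formulas, redFormula I₀ φ = ψ) ∧ [] ∉ ψ := by
  unfold kept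
  rw [List.mem_filter, List.mem_map]
  simp

/-- The formulas of `toPInst` are kept formulas. [folklore] -/
theorem toPInst_φ_mem (j : Fin (toPInst I₀).ν) : (toPInst I₀).φ j ∈ kept I₀ := List.getElem_mem _

/-- A kept formula is one of the formulas of `toPInst`. [folklore] -/
theorem exists_eq_φ_of_mem_kept {ψ : MonotoneDNF} (h : ψ ∈ kept I₀) : ∃ j : Fin (toPInst I₀).ν, (toPInst I₀).φ j = ψ := by
  obtain ⟨i, hi, rfl⟩ := List.getElem_of_mem h
  exact ⟨⟨i, hi⟩, rfl⟩

/-! ### Code length facts -/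

variable (I₀)

/-- The code of an instance, through the `CodeFP` encoders. [folklore] -/
theorem encode_eq : CMMSAInstance.encoding.encode I₀ = toE I₀.toTuple := by
  rw [CMMSAInstance.encoding_encode, toE_eq]

/-- The weight list is shorter than the code. [folklore] -/
theorem two_mul_length_weight_le_codeLen : 2 * I₀.weight.length ≤ codeLen I₀ := by
  unfold codeLen
  rw [encode_eq]
  simp only [toE, CodeFP.pairE_apply, CMMSAInstance.toTuple, CodeFP.listE, length_boolPair, CodeFP.length_unE]
  omega

/-- The formula list is shorter than the code. [folklore] -/
theorem numFormulas_le_codeLen : I₀.numFormulas ≤ codeLen I₀ := by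
  unfold codeLen CMMSAInstance.numFormulas
  rw [encode_eq]
  simp only [toE, CodeFP.pairE_apply, CMMSAInstance.toTuple, CodeFP.listE, length_boolPair, CodeFP.length_unE]
  omega

/-- The sum of the weights is at most half the code length. [folklore] -/
theorem two_mul_sum_weight_le_codeLen : 2 * I₀.weight.sum ≤ codeLen I₀ := by
  unfold codeLen
  rw [encode_eq]
  simp only [toE, CodeFP.pairE_apply, CMMSAInstance.toTuple, CodeFP.listE, length_boolPair, CodeFP.length_unE]
  have h : ∀ l : List ℕ, 2 * l.sum ≤ (l.map fun a => 2 * a + 2).sum := by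
    intro l
    induction l with
    | nil => simp
    | cons a l ih => simp only [List.sum_cons, List.map_cons]; omega
  have hmap : (I₀.weight.map fun a => 2 * (CodeFP.unE a).length + 2) = I₀.weight.map fun a => 2 * a + 2 := by
    simp [CodeFP.length_unE]
  have h' := h I₀.weight
  rw [← hmap, ← CodeFP.length_rawE] at h'
  omega

variable {I₀}

/-- For a well-formed instance, `W = Σ weights`. [folklore] -/
theorem totalW_eq_sum (hwf : I₀.weight.length = I₀.numVars) : totalW I₀ = I₀.weight.sum := by
  unfold totalW CMMSAInstance.w
  rw [← hwf, ← MonotoneDNF.sum_map_range_eq_finset_sum]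
  have := MonotoneDNF.sum_map_range_getD I₀.weight 0 id
  rw [List.map_id] at this
  exact this

/-! ### Well-formedness and largeness of the preprocessed instance -/

/-- **`Good` for promise instances.** [cite: Hirahara2022PartialMCSP, Def. 5.1 and proof of Lemma 8.3] -/
theorem toPInst_good (h2 : 2 ≤ I₀.numVars) (hwf : I₀.WellFormed) (hdeg : I₀.degree ≤ sqrtLog I₀.numVars)
    (hne : [] ∉ I₀.formulas) : (toPInst I₀).Good where
  two_le_n := h2
  nil_notMem j := (mem_kept_iff.1 (toPInst_φ_mem j)).2
  ne_nil j := by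
    obtain ⟨⟨φ, hφ, hψ⟩, -⟩ := mem_kept_iff.1 (toPInst_φ_mem j)
    rw [← hψ]
    exact redFormula_ne_nil fun h => hne (h ▸ hφ)
  numLiterals_le j := by
    obtain ⟨⟨φ, hφ, hψ⟩, -⟩ := mem_kept_iff.1 (toPInst_φ_mem j)
    rw [← hψ]
    exact (numLiterals_redFormula_le φ).trans ((I₀.degree_le_iff _).1 hdeg φ hφ)
  isOver j := by
    obtain ⟨⟨φ, hφ, hψ⟩, -⟩ := mem_kept_iff.1 (toPInst_φ_mem j)
    rw [← hψ]
    exact isOver_redFormula (hwf.2 φ hφ)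
  four_le_logLam := by change 4 ≤ logLamOf I₀; unfold logLamOf; omega

/-- `L' < 2^{⌊log₂ L'⌋ + 1}`. [folklore] -/
theorem sizeOf_lt_two_pow : sizeOf I₀ < 2 ^ (Nat.log 2 (sizeOf I₀) + 1) :=
  Nat.lt_pow_succ_log_self (by norm_num) _

/-- For well-formed instances `L' ≤ 2 |code|`. [folklore] -/
theorem sizeOf_le (hwf : I₀.weight.length = I₀.numVars) : sizeOf I₀ ≤ 2 * codeLen I₀ := by
  unfold sizeOf
  have h1 := two_mul_length_weight_le_codeLen I₀
  have h2 := numFormulas_le_codeLen I₀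
  have h3 := two_mul_sum_weight_le_codeLen I₀
  rw [hwf] at h1
  rw [totalW_eq_sum hwf]
  omega

/-- **`Big` for promise instances with `θ < W`.** [cite: Hirahara2022PartialMCSP, proof of Lemma 8.3 ("λ := max{…}", "for all sufficiently large n")] -/
theorem toPInst_big (h2 : 2 ≤ I₀.numVars) (hwf : I₀.WellFormed) (hdeg : I₀.degree ≤ sqrtLog I₀.numVars)
    (hne : [] ∉ I₀.formulas) (hθ : I₀.threshold < totalW I₀) : (toPInst I₀).Big := by
  have hcode := sizeOf_lt_two_pow (I₀ := I₀)
  have hΛ4 : (toPInst I₀).logLam / 4 = Nat.log 2 (sizeOf I₀) + 1 + 1024 := by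
    change logLamOf I₀ / 4 = _; unfold logLamOf; omega
  have hΛ : Nat.log 2 (sizeOf I₀) + 1 ≤ (toPInst I₀).logLam := by
    change _ ≤ logLamOf I₀; unfold logLamOf; omega
  have hsmall : sizeOf I₀ ≤ 2 ^ ((toPInst I₀).logLam / 4) :=
    hcode.le.trans (Nat.pow_le_pow_right (by norm_num) (by rw [hΛ4]; omega))
  have hbig : sizeOf I₀ ≤ 2 ^ (toPInst I₀).logLam := hcode.le.trans (Nat.pow_le_pow_right (by norm_num) hΛ)
  have hn : I₀.numVars ≤ sizeOf I₀ := by unfold sizeOf; omega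
  have hW : totalW I₀ ≤ sizeOf I₀ := by unfold sizeOf; omega
  refine ⟨toPInst_good h2 hwf hdeg hne, ?_, hn.trans hsmall, ?_, fun k => ?_, ?_⟩
  · change 4096 ≤ logLamOf I₀; unfold logLamOf; omega
  · change (kept I₀).length ≤ _
    calc (kept I₀).length ≤ (I₀.formulas.map (redFormula I₀)).length := List.length_filter_le _ _
      _ = I₀.numFormulas := by rw [List.length_map]; rfl
      _ ≤ sizeOf I₀ := by unfold sizeOf; omega
      _ ≤ _ := hsmall
  · change I₀.w k ≤ _
    have hk : I₀.w k ≤ totalW I₀ := by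
      unfold totalW
      exact Finset.single_le_sum (f := fun i => I₀.w i) (fun _ _ => Nat.zero_le _) (Finset.mem_range.2 k.isLt)
    exact hk.trans (hW.trans hbig)
  · change I₀.threshold ≤ _
    exact hθ.le.trans (hW.trans hbig)

/-! ### Witnesses and the no-promise -/

/-- **A light satisfying assignment gives a witness set**: positive-weight true variables.
[cite: Hirahara2022PartialMCSP, proof of Lemma 8.3 (completeness: "Let T ⊆ [n] … w(T) ≤ θ")] -/
theorem exists_witness_of_assignment (hwf : I₀.WellFormed) {a : ℕ → Bool} (hθ : I₀.weightOf a ≤ I₀.threshold)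
    (hsat : ∀ φ ∈ I₀.formulas, φ.eval a = true) :
    ∃ T : Finset (Fin (toPInst I₀).n), (∀ k ∈ T, 1 ≤ (toPInst I₀).w k) ∧ ∑ k ∈ T, (toPInst I₀).w k ≤ (toPInst I₀).θ ∧
      ∀ j, T.image Fin.val ∈ ((toPInst I₀).φ j).accessStructure.authorized := by
  classical
  refine ⟨univ.filter fun k : Fin I₀.numVars => a k.val = true ∧ I₀.w k.val ≠ 0, fun k hk => ?_, ?_, fun j => ?_⟩
  · have := (mem_filter.1 hk).2.2; change 1 ≤ I₀.w k; omega
  · change ∑ k ∈ univ.filter (fun k : Fin I₀.numVars => a k.val = true ∧ I₀.w k.val ≠ 0), I₀.w k ≤ I₀.threshold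
    refine le_trans ?_ hθ
    unfold CMMSAInstance.weightOf
    rw [Finset.sum_filter, ← Fin.sum_univ_eq_sum_range]
    refine Finset.sum_le_sum fun k _ => ?_
    by_cases h : a k.val = true ∧ I₀.w k.val ≠ 0
    · rw [if_pos h, if_pos h.1]
    · rw [if_neg h]; exact Nat.zero_le _
  · obtain ⟨⟨φ, hφ, hψ⟩, -⟩ := mem_kept_iff.1 (toPInst_φ_mem j)
    rw [← hψ]
    obtain ⟨t, ht, hta⟩ := (MonotoneDNF.eval_eq_true_iff _ _).1 (hsat φ hφ)
    refine ⟨t.filter fun v => decide (I₀.w v ≠ 0), List.mem_map.2 ⟨t, ht, rfl⟩, fun i hi => ?_⟩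
    obtain ⟨hit, hwi⟩ := List.mem_filter.1 hi
    have hin : i < I₀.numVars := hwf.2 φ hφ t ht i hit
    rw [mem_image]
    exact ⟨⟨i, hin⟩, mem_filter.2 ⟨mem_univ _, hta i hit, by simpa using hwi⟩, rfl⟩

/-- **Yes-instances give witnesses.** [cite: Hirahara2022PartialMCSP, Def. 5.1 (Yes) and proof of Lemma 8.3 (completeness)] -/
theorem exists_witness_of_yes {Δf : ℕ → ℕ} (h : I₀ ∈ MetaComplexity.CMMSA.yesSet Δf) :
    ∃ T : Finset (Fin (toPInst I₀).n), (∀ k ∈ T, 1 ≤ (toPInst I₀).w k) ∧ ∑ k ∈ T, (toPInst I₀).w k ≤ (toPInst I₀).θ ∧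
      ∀ j, T.image Fin.val ∈ ((toPInst I₀).φ j).accessStructure.authorized := by
  obtain ⟨hwf, -, a, hθ, hsat⟩ := h
  exact exists_witness_of_assignment hwf hθ hsat

/-- The assignment "in `S` or weight `0`" has weight `w(S)` and satisfies every formula whose kept
reduction (if kept) accepts `S`. [cite: Hirahara2022PartialMCSP, proof of Lemma 8.3 (soundness: the assignment χ_B)] -/
theorem weightOf_indicator (S : Finset (Fin I₀.numVars)) :
    I₀.weightOf (fun v => decide (v ∈ S.image Fin.val) || decide (I₀.w v = 0)) = ∑ k ∈ S, I₀.w k := by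
  classical
  unfold CMMSAInstance.weightOf
  rw [← Fin.sum_univ_eq_sum_range]
  rw [← Finset.sum_filter_add_sum_filter_not univ (fun k : Fin I₀.numVars => k ∈ S)]
  have h1 : ∑ k ∈ univ.filter (fun k : Fin I₀.numVars => k ∈ S),
      (if (decide ((k : ℕ) ∈ S.image Fin.val) || decide (I₀.w k = 0)) = true then I₀.w k else 0) = ∑ k ∈ S, I₀.w k := by
    rw [Finset.filter_mem_eq_inter, Finset.univ_inter]
    refine Finset.sum_congr rfl fun k hk => ?_
    have : (k : ℕ) ∈ S.image Fin.val := mem_image.2 ⟨k, hk, rfl⟩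
    simp [this]
  have h2 : ∑ k ∈ univ.filter (fun k : Fin I₀.numVars => ¬k ∈ S),
      (if (decide ((k : ℕ) ∈ S.image Fin.val) || decide (I₀.w k = 0)) = true then I₀.w k else 0) = 0 := by
    refine Finset.sum_eq_zero fun k hk => ?_
    have hkS : k ∉ S := (mem_filter.1 hk).2
    have : (k : ℕ) ∉ S.image Fin.val := by
      rw [mem_image]; rintro ⟨k', hk', hkk'⟩; exact hkS (Fin.ext hkk' ▸ hk')
    by_cases hw : I₀.w k = 0
    · simp [hw]
    · simp [this, hw]
  rw [h1, h2, add_zero]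

/-- Every formula is satisfied by "in `S` or weight `0`" when all kept formulas accept `S`.
[cite: Hirahara2022PartialMCSP, proof of Lemma 8.3 (soundness)] -/
theorem eval_indicator_of_authorized (S : Finset (Fin I₀.numVars))
    (hS : ∀ j, S.image Fin.val ∈ ((toPInst I₀).φ j).accessStructure.authorized) (φ : MonotoneDNF) (hφ : φ ∈ I₀.formulas) :
    φ.eval (fun v => decide (v ∈ S.image Fin.val) || decide (I₀.w v = 0)) = true := by
  rw [← eval_redFormula, MonotoneDNF.eval_eq_true_iff]
  by_cases hk : [] ∈ redFormula I₀ φ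
  · exact ⟨[], hk, fun i hi => by simp at hi⟩
  · have hmem : redFormula I₀ φ ∈ kept I₀ := mem_kept_iff.2 ⟨⟨φ, hφ, rfl⟩, hk⟩
    obtain ⟨j, hj⟩ := exists_eq_φ_of_mem_kept hmem
    have h := hS j
    rw [hj] at h
    obtain ⟨t, ht, htS⟩ := h
    exact ⟨t, ht, fun i hi => by simpa using htS i hi⟩

/-- **The no-promise makes every accepted set heavy**: if every assignment of weight `≤ g(n) θ`
satisfies fewer than `ε(n) · m ≤ m` formulas, then every `S` accepted by all kept formulas has weight
`> ⌊g(n) θ⌋`. [cite: Hirahara2022PartialMCSP, Def. 5.1 (No) and proof of Lemma 8.3 (soundness: "which implies that w(B) < θ" — contrapositive)] -/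
theorem heavy_of_no {g ε : ℕ → ℝ} (h : I₀ ∈ MetaComplexity.CMMSA.noSet g ε sqrtLog) (hε : ε I₀.numVars ≤ 1)
    (hg : 0 ≤ g I₀.numVars) (hν : 0 < (toPInst I₀).ν) (S : Finset (Fin (toPInst I₀).n))
    (hS : ∀ j, S.image Fin.val ∈ ((toPInst I₀).φ j).accessStructure.authorized) :
    ⌊g I₀.numVars * I₀.threshold⌋₊ < ∑ k ∈ S, (toPInst I₀).w k := by
  obtain ⟨hwf, -, hno⟩ := h
  by_contra hle
  rw [not_lt] at hle
  set a : ℕ → Bool := fun v => decide (v ∈ S.image Fin.val) || decide (I₀.w v = 0) with ha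
  have hwS : I₀.weightOf a = ∑ k ∈ S, I₀.w k := weightOf_indicator (I₀ := I₀) S
  have hwt : (I₀.weightOf a : ℝ) ≤ g I₀.numVars * I₀.threshold := by
    rw [hwS]
    have h1 : ((∑ k ∈ S, I₀.w k : ℕ) : ℝ) ≤ ⌊g I₀.numVars * I₀.threshold⌋₊ := by exact_mod_cast hle
    exact h1.trans (Nat.floor_le (by positivity))
  have hsat : I₀.satCount a = I₀.numFormulas := by
    unfold CMMSAInstance.satCount CMMSAInstance.numFormulas
    rw [List.countP_eq_length]
    intro φ hφ
    exact eval_indicator_of_authorized S hS φ hφ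
  have hlt := hno a hwt
  rw [hsat] at hlt
  have hm : 1 ≤ I₀.numFormulas := by
    have : (toPInst I₀).ν ≤ I₀.numFormulas := by
      change (kept I₀).length ≤ _
      calc (kept I₀).length ≤ (I₀.formulas.map (redFormula I₀)).length := List.length_filter_le _ _
        _ = I₀.numFormulas := by rw [List.length_map]; rfl
    omega
  have hmR : (1 : ℝ) ≤ I₀.numFormulas := by exact_mod_cast hm
  have : (I₀.numFormulas : ℝ) < I₀.numFormulas := by
    calc (I₀.numFormulas : ℝ) < ε I₀.numVars * I₀.numFormulas := hlt
      _ ≤ 1 * I₀.numFormulas := by gcongr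
      _ = I₀.numFormulas := one_mul _
  exact lt_irrefl _ this

end Pre

end HiraharaRed

end Literature.Computability.Complexity
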